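import Summits.BirchSwinnertonDyer.BirchSwinnertonDyer.Theses.KimAtThreeKolyvagin
import Summits.BirchSwinnertonDyer.BirchSwinnertonDyer.Theorems.SchneiderFreeAdditiveX3PoitouTateSelmerDualityHolds
import HarnessLib

set_option linter.dupNamespace false -- `…BirchSwinnertonDyer.BirchSwinnertonDyer…` is the cell's nested layout (D-0017)
set_option autoImplicit false

/-!
# Item 19559 `PoitouTateSelmerDuality` (route `KimAtThreeKolyvagin`, support r303) — Poitou–Tate duality for Selmer structures
# over `ℚ` — PROVED BY NAME (LADDER-BSD D-0154 (2), INPUTS-LIST-1 v2 DELTA-4 TRANCHE ENTRY #3)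

Seat `bsd-inputs-honda-p1` (gen 6, idle INPUTS prover of the desk `pub/bsd-wall/bsd-inputs`), `--workitem`
stmt-BirchSwinnertonDyer-19559. THEOREMS ONLY (no definition, no named fact, no `sorry`).

The item is the named published fact `Literature.NumberTheory.GaloisCohomology.poitouTate_selmerStructure_duality ℚ` (Milne *ADT* I
Thm. 4.10 (b), Howard 2004 Thm. 2.1.11, Mazur–Rubin 2004 Thm. 2.3.4), the `K = ℚ` instance of the tree theorem
`Summit.BirchSwinnertonDyer.BirchSwinnertonDyer.Theorems.SchneiderFreeAdditiveX3.PoitouTateReduction.poitouTate_selmerStructure_duality_holds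
(K : Type) [Field K] [NumberField K]` (cell `bsd-schneider`, door-c4 g18, p624636). This leaf file records it against the route
declaration `Theses.KimAtThreeKolyvagin.PoitouTateSelmerDuality` (a `def … : Prop :=` alias of the item signature) by `unfold; exact`.
Nothing is re-derived; no landed declaration is restated.

## Honest framing

UNCONDITIONAL (classical Poitou–Tate duality, kernel-checked by the `bsd-schneider` cell). Closing item 19559 discharges the `hPT`-type
binder of `KimAtThreeKolyvagin`'s `DeepUpperAtThree` package AS TYPED only; the route's cruxes are not proved; no summit statement is
proved; the Birch–Swinnerton-Dyer conjecture is NOT proved by any of this.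

References: [MilneADT2006] Ch. I, Thm. 4.10 (b); [Howard2004HeegnerKolyvagin] Thm. 2.1.11; [Rubin2000] Thm. 1.7.3.
-/

namespace Summit.BirchSwinnertonDyer.BirchSwinnertonDyer.Theorems.InputsPoitouTateSelmer

open Literature.NumberTheory.GaloisCohomology

/-- **Item 19559 on route `KimAtThreeKolyvagin` — `PoitouTateSelmerDuality` PROVED (by name):** Poitou–Tate duality for Selmer
structures over `ℚ`, `poitouTate_selmerStructure_duality ℚ`, the `K = ℚ` instance of
`SchneiderFreeAdditiveX3.PoitouTateReduction.poitouTate_selmerStructure_duality_holds` (cell `bsd-schneider`, p624636).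
Unconditional; closes item 19559; BSD is not proved by this. [cite: MilneADT2006, Ch. I, Thm. 4.10 (b) (proof, p. 58)]
[cite: Howard2004HeegnerKolyvagin, Thm. 2.1.11 (arXiv:1202.6340 p. 6)] -/
theorem kimAtThreeKolyvagin_poitouTateSelmerDuality_proof :
    Summit.BirchSwinnertonDyer.BirchSwinnertonDyer.Theses.KimAtThreeKolyvagin.PoitouTateSelmerDuality := by
  unfold Summit.BirchSwinnertonDyer.BirchSwinnertonDyer.Theses.KimAtThreeKolyvagin.PoitouTateSelmerDuality
  exact SchneiderFreeAdditiveX3.PoitouTateReduction.poitouTate_selmerStructure_duality_holds ℚ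

end Summit.BirchSwinnertonDyer.BirchSwinnertonDyer.Theorems.InputsPoitouTateSelmer
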